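import Mathlib
import Summits.KontsevichZagierPeriods.Zeta5Search.SecondDigitVProof
import Summits.KontsevichZagierPeriods.Zeta5Search.SecondOrderTypes
import Summits.KontsevichZagierPeriods.Zeta5Search.UniversalDigitDischarge
import Summits.KontsevichZagierPeriods.Zeta5Search.RecordCellDProof
import HarnessLib

/-!
# ζ(5) search — the NORMALISED CLASS DIGITS to second order and the conjugate-pair weights (tools for THEOREM A‴ / `LawA3`)

Cell `pub-zeta5` (HONEST FRAMING: systematic search; no irrationality claim unless certified), typer seat generation 11.
REPORT-gen2-g10 §2.1/§3, per residue class `x` of `b` (window prime `5 ≤ p`, `b₀ + 2 < p²`; `m = −M` the minimal exponent):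
* deep classes (`E_x = m`): `W_x/(−p)^{m+3} ≡ ĝ_x(ŵ_x − pφ_xŵ₂_x)`, `V_x/(−p)^m ≡ ĝ_x(v̂_x − pφ_x v̂₂_x) (mod p²)`
  (`deepW_norm`, `deepV_norm`, from `secondDigitW/V_holds`);
* classes at the next level (`E_x = m+1`, any pole count): `W_x/(−p)^{m+3} ≡ −p ĝ_x ŵ_x`, `V_x/(−p)^m ≡ −p ĝ_x v̂_x (mod p²)`
  (`subW_norm`, `subV_norm`, from the first digits `wDigit`/`vDigit`);
* every other class contributes `O(p²)` (`restW_norm`, `restV_norm`: cluster bound, isolated poles, `ClassNuBound`);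
* the PAIR WEIGHTS: for a centre-free level class `x` with even `E_x`, `ĝ_x + ĝ_x̄ ≡ L p φ_x ĝ_x (mod p²)` (`gHat_pair_second`, from G2
  exact and `ĝ_{x+Lp} ≡ ĝ_x(1 − Lpφ_x)`), and with odd `E_x`, `ĝ_x̄ ≡ ĝ_x (mod p)` (`gHat_pair_first`);
* TAME classes at level `m+1` have vanishing digits `ĝŵ ≡ ĝv̂ ≡ 0 (mod p)` (`tame_digits_norm`).
`p`-adic norms of rational numbers; nothing here bears on irrationality.
-/

noncomputable section

open Finset PowerSeries

namespace Summit.KontsevichZagierPeriods.Zeta5Search.SecondOrder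

open Summit.KontsevichZagierPeriods.Zeta5Search.DualSeries (InBox)
open Summit.KontsevichZagierPeriods.Zeta5Search.WedgeDictionary (pfData)
open Summit.KontsevichZagierPeriods.Zeta5Search.CasoratianValuation (InPolytope)
open Summit.KontsevichZagierPeriods.Zeta5Search.ClusterValuation
open Summit.KontsevichZagierPeriods.Zeta5Search.PadicSeries
open Summit.KontsevichZagierPeriods.Zeta5Search.CellA (classW padicNorm_pow_eq padicNorm_p gHat_conj)
open Summit.KontsevichZagierPeriods.Zeta5Search.LevelClass (typeExp level_mem)

variable {p : ℕ} [hp : Fact p.Prime]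

/-! ## §1 Normalisation helper -/

/-- `‖D‖ ≤ p^{−(a+c)}` gives `‖D/(−p)^a‖ ≤ p^{−c}`. -/
theorem norm_div_neg_p_zpow {D : ℚ} {a c : ℤ} (h : padicNorm p D ≤ (p : ℚ) ^ (-(a + c))) :
    padicNorm p (D / (-(p : ℚ)) ^ a) ≤ (p : ℚ) ^ (-c) := by
  have hp0 : (p : ℚ) ≠ 0 := Nat.cast_ne_zero.2 hp.out.ne_zero
  rw [padicNorm.div, LevelClass.padicNorm_neg_p_zpow, div_le_iff₀ (zpow_pos (by exact_mod_cast hp.out.pos) _), ← zpow_add₀ hp0]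
  rwa [show -c + -a = -(a + c) by ring]

/-! ## §2 Normalised class digits -/

section Digits

variable (b : ℕ → ℤ) (hb : InPolytope b) (hp5 : 5 ≤ p) (hwin : (b 0 + 2 : ℤ) < (p : ℤ) ^ 2) {x : ℕ} (hx : x < p)
include hb hp5 hwin hx

/-- **Deep `W`**: `‖W_x/(−p)^{E+3} − ĝ_x(ŵ_x − pφ_xŵ₂_x)‖ ≤ p⁻²`. -/
theorem deepW_norm (hpole : 1 ≤ classPoleCount b p x) :
    padicNorm p (classW b p x / (-(p : ℚ)) ^ (classExp b p x + 3)
      - gHat b p x * (wHat b p x - (p : ℚ) * phiHat b p x * wHat2 b p x)) ≤ (p : ℚ) ^ (-(2 : ℤ)) := by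
  have hp' : (-(p : ℚ)) ^ (classExp b p x + 3) ≠ 0 := zpow_ne_zero _ (neg_ne_zero.2 (Nat.cast_ne_zero.2 hp.out.ne_zero))
  have h := padicNorm_le_of_val (p := p) fun hne => secondDigitW_holds b p x hb hp.out hp5 hwin hx hpole hne
  have e : classW b p x / (-(p : ℚ)) ^ (classExp b p x + 3)
      - gHat b p x * (wHat b p x - (p : ℚ) * phiHat b p x * wHat2 b p x) =
      ((∑ s ∈ classSet b p x, pfData b 2 s)
        - (-(p : ℚ)) ^ (classExp b p x + 3) * gHat b p x * (wHat b p x - (p : ℚ) * phiHat b p x * wHat2 b p x))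
        / (-(p : ℚ)) ^ (classExp b p x + 3) := by
    unfold classW; field_simp
  rw [e]
  exact norm_div_neg_p_zpow (by rwa [show classExp b p x + 3 + 2 = classExp b p x + 5 by ring])

/-- **Deep `V`** (`E_x ≤ −2`): `‖V_x/(−p)^E − ĝ_x(v̂_x − pφ_x v̂₂_x)‖ ≤ p⁻²`. -/
theorem deepV_norm (hpole : 1 ≤ classPoleCount b p x) (hE2 : classExp b p x ≤ -2) :
    padicNorm p (classV b p x / (-(p : ℚ)) ^ (classExp b p x)
      - gHat b p x * (vHat b p x - (p : ℚ) * phiHat b p x * vHat2 b p x)) ≤ (p : ℚ) ^ (-(2 : ℤ)) := by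
  have hp' : (-(p : ℚ)) ^ (classExp b p x) ≠ 0 := zpow_ne_zero _ (neg_ne_zero.2 (Nat.cast_ne_zero.2 hp.out.ne_zero))
  have h := padicNorm_le_of_val (p := p) fun hne => secondDigitV_holds b p x hb hp.out hp5 hwin hx hpole hE2 hne
  have e : classV b p x / (-(p : ℚ)) ^ (classExp b p x)
      - gHat b p x * (vHat b p x - (p : ℚ) * phiHat b p x * vHat2 b p x) =
      (classV b p x
        - (-(p : ℚ)) ^ (classExp b p x) * gHat b p x * (vHat b p x - (p : ℚ) * phiHat b p x * vHat2 b p x))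
        / (-(p : ℚ)) ^ (classExp b p x) := by
    field_simp
  rw [e]
  exact norm_div_neg_p_zpow h

/-- **First digit of `W`, normalised at `m + 3` for a class of exponent `m + 1`**: `‖W_x/(−p)^{m+3} + p ĝ_x ŵ_x‖ ≤ p⁻²`. -/
theorem subW_norm (hpole : 1 ≤ classPoleCount b p x) {m : ℤ} (hE : classExp b p x = m + 1) :
    padicNorm p (classW b p x / (-(p : ℚ)) ^ (m + 3) + (p : ℚ) * gHat b p x * wHat b p x) ≤ (p : ℚ) ^ (-(2 : ℤ)) := by
  have hpneg : (-(p : ℚ)) ≠ 0 := neg_ne_zero.2 (Nat.cast_ne_zero.2 hp.out.ne_zero)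
  obtain ⟨q, hq⟩ := card_pos.1 (show 0 < ((classSet b p x).filter fun s => netExp b s < 0).card from hpole)
  obtain ⟨hqc, hqneg⟩ := mem_filter.1 hq
  have hxmem : x ∈ classSet b p x := base_mem_classSet b hx hpole
  have hW := padicNorm_le_of_val (p := p) fun hne => wDigit_holds b p x q hb hp.out hp5 hwin hx hqc hqneg hne
  -- move the unit from `q` to the base `x`
  obtain ⟨hgq1, hgg⟩ := padicNorm_gHat_class b hb hp5 hx hqc hxmem
  have hw1 : padicNorm p (wHat b p x) ≤ 1 := by
    have := LevelClass.padicNorm_wHat_le_one b hb.1.1 (thmA_data b hb hwin).2.2.2 (by omega) x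
    exact this
  have hW' : padicNorm p ((∑ s ∈ classSet b p x, pfData b 2 s) - (-(p : ℚ)) ^ (classExp b p x + 3) * gHat b p x * wHat b p x)
      ≤ (p : ℚ) ^ (-(classExp b p x + 4)) := by
    have e : (∑ s ∈ classSet b p x, pfData b 2 s) - (-(p : ℚ)) ^ (classExp b p x + 3) * gHat b p x * wHat b p x =
        ((∑ s ∈ classSet b p x, pfData b 2 s) - (-(p : ℚ)) ^ (classExp b p x + 3) * gHat b p q * wHat b p x)
          + (-(p : ℚ)) ^ (classExp b p x + 3) * (gHat b p q - gHat b p x) * wHat b p x := by ring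
    rw [e]
    refine (padicNorm.nonarchimedean (p := p)).trans (max_le hW ?_)
    rw [padicNorm.mul, padicNorm.mul, LevelClass.padicNorm_neg_p_zpow]
    calc (p : ℚ) ^ (-(classExp b p x + 3)) * padicNorm p (gHat b p q - gHat b p x) * padicNorm p (wHat b p x)
        ≤ (p : ℚ) ^ (-(classExp b p x + 3)) * (p : ℚ) ^ (-(1 : ℤ)) * 1 :=
          mul_le_mul (mul_le_mul_of_nonneg_left hgg (zpow_p_nonneg _)) hw1 (padicNorm.nonneg _)
            (mul_nonneg (zpow_p_nonneg _) (zpow_p_nonneg _))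
      _ = (p : ℚ) ^ (-(classExp b p x + 4)) := by
          rw [mul_one, ← zpow_add₀ (Nat.cast_ne_zero.2 hp.out.ne_zero)]; ring_nf
  have e : classW b p x / (-(p : ℚ)) ^ (m + 3) + (p : ℚ) * gHat b p x * wHat b p x =
      ((∑ s ∈ classSet b p x, pfData b 2 s) - (-(p : ℚ)) ^ (classExp b p x + 3) * gHat b p x * wHat b p x)
        / (-(p : ℚ)) ^ (m + 3) := by
    unfold classW
    rw [hE, show m + 1 + 3 = (m + 3) + 1 by ring, zpow_add_one₀ hpneg]
    field_simp
    ring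
  rw [e]
  have hexp : -(classExp b p x + 4) = -((m + 3) + 2) := by rw [hE]; ring
  rw [hexp] at hW'
  exact norm_div_neg_p_zpow hW'

/-- **First digit of `V`, normalised at `m` for a class of exponent `m + 1`**: `‖V_x/(−p)^m + p ĝ_x v̂_x‖ ≤ p⁻²`. -/
theorem subV_norm (hpole : 1 ≤ classPoleCount b p x) {m : ℤ} (hE : classExp b p x = m + 1) :
    padicNorm p (classV b p x / (-(p : ℚ)) ^ m + (p : ℚ) * gHat b p x * vHat b p x) ≤ (p : ℚ) ^ (-(2 : ℤ)) := by
  have hpneg : (-(p : ℚ)) ≠ 0 := neg_ne_zero.2 (Nat.cast_ne_zero.2 hp.out.ne_zero)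
  obtain ⟨q, hq⟩ := card_pos.1 (show 0 < ((classSet b p x).filter fun s => netExp b s < 0).card from hpole)
  obtain ⟨hqc, hqneg⟩ := mem_filter.1 hq
  have hxmem : x ∈ classSet b p x := base_mem_classSet b hx hpole
  have hV := padicNorm_le_of_val (p := p) fun hne => vDigit_holds b p x q hb hp.out hp5 hwin hx hqc hqneg hne
  obtain ⟨hgq1, hgg⟩ := padicNorm_gHat_class b hb hp5 hx hqc hxmem
  have hv1 : padicNorm p (vHat b p x) ≤ 1 :=
    LevelClass.padicNorm_vHat_le_one b hb.1.1 (thmA_data b hb hwin).2.2.2 (by omega)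
  have hV' : padicNorm p (classV b p x - (-(p : ℚ)) ^ (classExp b p x) * gHat b p x * vHat b p x)
      ≤ (p : ℚ) ^ (-(classExp b p x + 1)) := by
    have e : classV b p x - (-(p : ℚ)) ^ (classExp b p x) * gHat b p x * vHat b p x =
        (classV b p x - (-(p : ℚ)) ^ (classExp b p x) * gHat b p q * vHat b p x)
          + (-(p : ℚ)) ^ (classExp b p x) * (gHat b p q - gHat b p x) * vHat b p x := by ring
    rw [e]
    refine (padicNorm.nonarchimedean (p := p)).trans (max_le hV ?_)
    rw [padicNorm.mul, padicNorm.mul, LevelClass.padicNorm_neg_p_zpow]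
    calc (p : ℚ) ^ (-(classExp b p x)) * padicNorm p (gHat b p q - gHat b p x) * padicNorm p (vHat b p x)
        ≤ (p : ℚ) ^ (-(classExp b p x)) * (p : ℚ) ^ (-(1 : ℤ)) * 1 :=
          mul_le_mul (mul_le_mul_of_nonneg_left hgg (zpow_p_nonneg _)) hv1 (padicNorm.nonneg _)
            (mul_nonneg (zpow_p_nonneg _) (zpow_p_nonneg _))
      _ = (p : ℚ) ^ (-(classExp b p x + 1)) := by
          rw [mul_one, ← zpow_add₀ (Nat.cast_ne_zero.2 hp.out.ne_zero)]; ring_nf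
  have e : classV b p x / (-(p : ℚ)) ^ m + (p : ℚ) * gHat b p x * vHat b p x =
      (classV b p x - (-(p : ℚ)) ^ (classExp b p x) * gHat b p x * vHat b p x) / (-(p : ℚ)) ^ m := by
    rw [hE, zpow_add_one₀ hpneg]
    field_simp
    ring
  rw [e]
  have hexp : -(classExp b p x + 1) = -(m + 2) := by rw [hE]; ring
  rw [hexp] at hV'
  exact norm_div_neg_p_zpow hV'

omit hx in
/-- **The rest, `W`**: a class without pole, with one pole, or with exponent `≥ m + 2` has `‖W_x/(−p)^{m+3}‖ ≤ p⁻²` (`m ≤ −5`). -/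
theorem restW_norm {m : ℤ} (hm : m ≤ -5) (hE : 2 ≤ classPoleCount b p x → m + 2 ≤ classExp b p x) :
    padicNorm p (classW b p x / (-(p : ℚ)) ^ (m + 3)) ≤ (p : ℚ) ^ (-(2 : ℤ)) := by
  have h := CellD.padicNorm_classW_le b hb hp5 hwin (m := m + 2) (by omega) hE
  exact norm_div_neg_p_zpow (by rwa [show m + 3 + 2 = m + 2 + 3 by ring])

/-- **The rest, `V`**: a class without pole or with `ν_x ≥ m + 2` has `‖V_x/(−p)^m‖ ≤ p⁻²`. -/
theorem restV_norm {m : ℤ} (hν : 1 ≤ classPoleCount b p x → m + 2 ≤ classNu b p x) :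
    padicNorm p (classV b p x / (-(p : ℚ)) ^ m) ≤ (p : ℚ) ^ (-(2 : ℤ)) := by
  have h := CellD.padicNorm_classV_le_of b hb hp5 hwin hx (v := m + 2) hν
  exact norm_div_neg_p_zpow h

/-- **Tame digits vanish**: a single-pole class with `ν_x ≠ E_x` (i.e. a tame class of negative exponent `E_x ≤ −4`) has
`‖ĝ_x ŵ_x‖ ≤ p⁻¹` and `‖ĝ_x v̂_x‖ ≤ p⁻¹` (its `W_x`, `V_x` are `p`-integral while the digit lemmas pin the digits). -/
theorem tame_digits_norm (hone : classPoleCount b p x = 1) (hE4 : classExp b p x ≤ -4) (hν : 0 ≤ classNu b p x) :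
    padicNorm p (gHat b p x * wHat b p x) ≤ (p : ℚ) ^ (-(1 : ℤ)) ∧
      padicNorm p (gHat b p x * vHat b p x) ≤ (p : ℚ) ^ (-(1 : ℤ)) := by
  have hp0 : (p : ℚ) ≠ 0 := Nat.cast_ne_zero.2 hp.out.ne_zero
  have hpneg : (-(p : ℚ)) ≠ 0 := neg_ne_zero.2 hp0
  have hpole : 1 ≤ classPoleCount b p x := by omega
  set E := classExp b p x with hEdef
  -- `W_x` and `V_x` are `p`-integral
  have hWint : padicNorm p (classW b p x) ≤ 1 := by
    have := CellD.padicNorm_classW_le b hb hp5 hwin (x := x) (m := -3) le_rfl (fun h2 => by omega)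
    simpa using this
  have hVint : padicNorm p (classV b p x) ≤ 1 := by
    have := CellD.padicNorm_classV_le_of b hb hp5 hwin hx (v := 0) (fun _ => hν)
    simpa using this
  -- the digit lemmas at exponent `E`
  have hW := subW_norm b hb hp5 hwin hx hpole (m := E - 1) (by ring)
  have hV := subV_norm b hb hp5 hwin hx hpole (m := E - 1) (by ring)
  have hp1 : (1 : ℚ) ≤ p := one_le_p
  constructor
  · -- `p ĝ ŵ = (W/(−p)^{E+2} + pĝŵ) − W/(−p)^{E+2}`
    have hWn : padicNorm p (classW b p x / (-(p : ℚ)) ^ (E - 1 + 3)) ≤ (p : ℚ) ^ (-(2 : ℤ)) := by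
      rw [padicNorm.div, LevelClass.padicNorm_neg_p_zpow, div_le_iff₀ (zpow_pos (by exact_mod_cast hp.out.pos) _), ← zpow_add₀ hp0]
      exact hWint.trans (one_le_zpow₀ hp1 (by omega))
    have hpg : padicNorm p ((p : ℚ) * gHat b p x * wHat b p x) ≤ (p : ℚ) ^ (-(2 : ℤ)) := by
      have e : (p : ℚ) * gHat b p x * wHat b p x =
          (classW b p x / (-(p : ℚ)) ^ (E - 1 + 3) + (p : ℚ) * gHat b p x * wHat b p x)
            - classW b p x / (-(p : ℚ)) ^ (E - 1 + 3) := by ring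
      rw [e]; exact (padicNorm.sub (p := p)).trans (max_le hW hWn)
    rw [mul_assoc, padicNorm.mul, padicNorm_p] at hpg
    calc padicNorm p (gHat b p x * wHat b p x)
        = (p : ℚ) ^ (1 : ℤ) * ((p : ℚ) ^ (-(1 : ℤ)) * padicNorm p (gHat b p x * wHat b p x)) := by
          rw [← mul_assoc, ← zpow_add₀ hp0]; norm_num
      _ ≤ (p : ℚ) ^ (1 : ℤ) * (p : ℚ) ^ (-(2 : ℤ)) := mul_le_mul_of_nonneg_left hpg (zpow_p_nonneg _)
      _ = (p : ℚ) ^ (-(1 : ℤ)) := by rw [← zpow_add₀ hp0]; norm_num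
  · have hVn : padicNorm p (classV b p x / (-(p : ℚ)) ^ (E - 1)) ≤ (p : ℚ) ^ (-(2 : ℤ)) := by
      rw [padicNorm.div, LevelClass.padicNorm_neg_p_zpow, div_le_iff₀ (zpow_pos (by exact_mod_cast hp.out.pos) _), ← zpow_add₀ hp0]
      exact hVint.trans (one_le_zpow₀ hp1 (by omega))
    have hpg : padicNorm p ((p : ℚ) * gHat b p x * vHat b p x) ≤ (p : ℚ) ^ (-(2 : ℤ)) := by
      have e : (p : ℚ) * gHat b p x * vHat b p x =
          (classV b p x / (-(p : ℚ)) ^ (E - 1) + (p : ℚ) * gHat b p x * vHat b p x)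
            - classV b p x / (-(p : ℚ)) ^ (E - 1) := by ring
      rw [e]; exact (padicNorm.sub (p := p)).trans (max_le hV hVn)
    rw [mul_assoc, padicNorm.mul, padicNorm_p] at hpg
    calc padicNorm p (gHat b p x * vHat b p x)
        = (p : ℚ) ^ (1 : ℤ) * ((p : ℚ) ^ (-(1 : ℤ)) * padicNorm p (gHat b p x * vHat b p x)) := by
          rw [← mul_assoc, ← zpow_add₀ hp0]; norm_num
      _ ≤ (p : ℚ) ^ (1 : ℤ) * (p : ℚ) ^ (-(2 : ℤ)) := mul_le_mul_of_nonneg_left hpg (zpow_p_nonneg _)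
      _ = (p : ℚ) ^ (-(1 : ℤ)) := by rw [← zpow_add₀ hp0]; norm_num

end Digits

/-! ## §3 The weights of a conjugate pair -/

section Pair

variable (b : ℕ → ℤ) (hb : InPolytope b) (hp5 : 5 ≤ p)
  {x L : ℕ} (hx : x < p) (hL : x + L * p ≤ (b 0).toNat) (hL' : (b 0).toNat < x + L * p + p) (hc : ¬ CentreIn b p x)
include hb hp5 hx hL hL' hc

/-- **Deep pair weight (even exponent)**: `‖(ĝ_x + ĝ_x̄) − L p φ_x ĝ_x‖ ≤ p⁻²` (`x̄ = conjClass b p x`). -/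
theorem gHat_pair_second (heven : Even (classExp b p x)) :
    padicNorm p (gHat b p x + gHat b p (conjClass b p x) - (L : ℚ) * p * phiHat b p x * gHat b p x) ≤
      (p : ℚ) ^ (-(2 : ℤ)) := by
  have hq := level_mem b hx hL hL' le_rfl
  have hconj : conjClass b p x = (b 0).toNat - (x + L * p) := CellKit.conjClass_eq_level b hL hL'
  have hG2 := gHat_conj b p x (x + L * p) hb hp.out hp5 hx hc hq
  have hodd : Odd (classExp b p x + 1) := heven.add_one
  rw [hodd.neg_one_zpow, neg_one_mul] at hG2
  have hS := padicNorm_gHat_sub_second_le b (by omega) hx hq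
  rw [level_div hx] at hS
  have e : gHat b p x + gHat b p (conjClass b p x) - (L : ℚ) * p * phiHat b p x * gHat b p x =
      -(gHat b p (x + L * p) - gHat b p x * (1 - (L : ℚ) * p * phiHat b p x)) := by
    rw [hconj, hG2]; ring
  rw [e, padicNorm.neg]
  exact hS

/-- **Pair weight at odd exponent**: `‖ĝ_x̄ − ĝ_x‖ ≤ p⁻¹`. -/
theorem gHat_pair_first (hodd : Odd (classExp b p x)) :
    padicNorm p (gHat b p (conjClass b p x) - gHat b p x) ≤ (p : ℚ) ^ (-(1 : ℤ)) := by
  have hq := level_mem b hx hL hL' le_rfl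
  have hx0 : x ∈ classSet b p x := by simpa using level_mem b hx hL hL' (Nat.zero_le L)
  have hconj : conjClass b p x = (b 0).toNat - (x + L * p) := CellKit.conjClass_eq_level b hL hL'
  have hG2 := gHat_conj b p x (x + L * p) hb hp.out hp5 hx hc hq
  have hev : Even (classExp b p x + 1) := hodd.add_one
  rw [hev.neg_one_zpow, one_mul] at hG2
  rw [hconj, hG2]
  exact (padicNorm_gHat_class b hb hp5 hx hq hx0).2

end Pair

end Summit.KontsevichZagierPeriods.Zeta5Search.SecondOrder

end
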